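/-
Copyright (c) 2026 the pub-hodgecm-mathlib formalisation cell (harness21).  Prover seat hodgecm-mathlib-K2E3-p11 (g10) (valve hand), Track B «K2-LIT»,
#184♮ = hLiu418 = `stmt-HodgeConjecture-24832`; socket #41, KIND W — LEAD F0P6-plan (g15) BATCH #191 (1) 2026-09-05T00:34:44Z «(KW-arch-hW)
`K2LiuKindWArchWhittakerLetterDispatch :: hW_of_signCases` = the PAYER BY NAME of the ONE by-value letter (β) `hW` that LH4-p10 (g8)'s
`K2LiuKindWArchContinuationOfRecord :: hex_of_std` keeps, dispatching on the sign type of the framed index»; census 00:38:09Z (G1)–(G4), LH4-p08 (g11) «=» 00:38:27Z;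
KW desk F0P2-p08 (g3).  THEOREMS ONLY (no `def`, no `instance`, no notation, no named-fact hypothesis, no `sorry`).
-/
import Summits.HodgeConjecture.HodgeConjecture.Theorems.K2LiuKindWArchWhittakerLetter        -- ★ p863390 LH4-p08: the POSITIVE-DEFINITE letter (by name)
import Summits.HodgeConjecture.HodgeConjecture.Theorems.K2LiuKindWArchWhittakerLetterNegDef  -- ★ LH4-p08 W2-mirror: the NEGATIVE-DEFINITE letter (by name)
import Summits.HodgeConjecture.HodgeConjecture.Theorems.K2LiuKindWArchWhittakerKPicture      -- ★ p863502 (this seat) W1: `kPicture_rightTranslate` (the `hKpic` bridge), `det_ne_zero_of_unitary`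
import Mathlib.Analysis.Complex.Convex
import Mathlib.Analysis.Complex.CauchyIntegral
import HarnessLib

/-!
# Crux `HLiu418`, socket #41, KIND W — `K2LiuKindWArchWhittakerLetterDispatch`: the per-place archimedean Whittaker letter `hW`, DISPATCHED ON THE SIGN OF THE FRAMED INDEX

Cell `hodgecm-mathlib`, crux item hLiu418 = `stmt-HodgeConjecture-24832` (helper lane `--supports … --as helper`, count-neutral).  THE LETTER PAID (bytes = ★ p863572
`K2LiuKindWArchContinuationBridge` §1's `hW` binder ∕ LH4-p10's `K2LiuKindWArchContinuationOfRecord` cand v2 :123–131, at generic index types and a generic abscissa `s₁`;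
GUARDED per `S` by a predicate `good` — the consumer instantiates `good S := det ↑S ≠ 0` (KW desk byte repair of record 00:42:11Z, the `hW'` siblings), `k w := -(t w.1)`,
`Pt S h w := Fr (h_∞·g) w`, `s₁ := 2∕2`):
  `∀ S, good S → ∀ h w Q, ∃ Ew, DifferentiableOn ℂ Ew {0 < re} ∧ ∀ s, s₁ < re s → ∀ F ∈ I_w(s, χ_{k w}) with compact picture Q,`
  `   ∫_{Herm₂} F((0 B_w; C_w 0) · n(b) · Pt S h w) · eb S h w (b) db = Ew s`.
THE THREE HEADS it dispatches to, by the sign type of the per-place hermitian index `hidx S h w` (`det ≠ 0`) reading the twist (`eb S h w b = e(−tr(hidx·b))`):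
POSITIVE DEFINITE — ★ `K2LiuKindWArchWhittakerLetter.exists_twistedWhittaker_continuation_of_posDef` BY NAME, its bridge `hKpic` PAID by ★ W1
`K2LiuKindWArchWhittakerKPicture.kPicture_rightTranslate`; NEGATIVE DEFINITE — ★ LH4-p08's W2-mirror `K2LiuKindWArchWhittakerLetterNegDef.exists_twistedWhittaker_continuation_of_negDef`
BY NAME (same bridge); INDEFINITE (signature (1,1), `det < 0`) — the «Φ6b-ind» organ (K2E4-p11), HYPOTHESIS-FIRST (`hInd`, the definite heads' telescope ∀-closed at
`hidxᴴ = hidx`, `hidx.det.re < 0` — KW desk (G3)).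
THE ONE ANALYTIC SEAM (census (G1), LH4-p08 «=»): the heads conclude on `{s₀ < re}` for an EXISTENTIAL abscissa (★ JUNCTION's `s₀ = |s₀′| + |k| + 4`), the binder pins
`s₁` (`= 2∕2` of record).  The upgrade is honest analysis, carried as ONE by-value letter `hWhol` («there is a family of sections `G s ∈ I_w(s, χ_k)` of picture `Q` whose twisted
integral is holomorphic on `{s₁ < re}`» — payer: the flat family + parametric holomorphy, (KW-arch-hW-hol)) and proved here by the IDENTITY THEOREM: every section with the
same `(s, χ, Q)` agrees with `G s` on `U(J)` (★ `apply_eq_mul_apply_kU` — §2 `apply_eq_of_picture_eq`), the integrand only visits `U(J)`, so the letter's left-hand side is ONE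
holomorphic function of `s`, equal to `Ew` on `{max s₀ s₁ < re}` hence on the connected `{s₁ < re}`.
* §1 `sign_trichotomy` — a `2 × 2` hermitian matrix with `det ≠ 0` is positive definite, negative definite, or has `det < 0` (Sylvester, ★ `posDef_hermTwo_iff`).
* §2 `apply_eq_of_picture_eq` ∕ `twistedIntegral_eq_of_picture_eq` (canonicity on `U(J)`), `hW_of_abscissa_of_hol` (the identity-theorem upgrade `∃ s₀ ⇒ s₁`).
* §3 HEAD `hW_of_signCases`.
BY-VALUE LETTERS of the head, with payers: `hk : ∀ w, -2 ≤ k w` ((G4), ★ JUNCTION's window — LOAD-BEARING, LH4-p08 00:38:27Z; = `t w.1 ≤ 2` at the consumer); frame letters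
`hx`, `hPt` (frame of record); the per-place INDEX READING `hidx, hherm, hdet, hebr` ((G2); payer: the per-place factorisation of `conj ψ_S ∘ ι_∞` through the frame,
K2Liu-p11's (α) lineage); `hWhol` ((G1)); `hInd` («Φ6b-ind»).
References: [Shimura1997] §16.4, §18.4; [KudlaRallis1994] §1–§2; [MoeglinWaldspurger1995] II.1.7, IV.1.9 (continuation and uniqueness).
HONEST LABEL.  Count-neutral helper; it moves `hW` onto {«Φ6b-ind» head, (KW-arch-hW-hol), (G2) index reading, (G4) window} (both DEFINITE heads are ★ by name): `HC_CM` is proved only modulo the 7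
printed citations (2 remaining named inputs: hLiu418 = `stmt-HodgeConjecture-24832`, h413 = `stmt-HodgeConjecture-24833`) until rung 0 closes.
-/

set_option autoImplicit false
set_option linter.dupNamespace false -- the mandated namespace repeats `HodgeConjecture.HodgeConjecture`

noncomputable section

open Complex Matrix MeasureTheory
open scoped ComplexConjugate ComplexOrder Topology

namespace Summit.HodgeConjecture.HodgeConjecture.Cruxes.HLiu418.K2LiuKindWArchWhittakerLetterDispatch

open Literature.NumberTheory.ModularForms.SiegelUpperHalfSpace (moeb)
open Summit.HodgeConjecture.HodgeConjecture.Cruxes.HLiu418.K2LiuHermTwoGammaDefs (hermTwo posDef_hermTwo_iff hermTwo_eq_of_isHermitian det_hermTwo)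
open Summit.HodgeConjecture.HodgeConjecture.Cruxes.HLiu418.K2LiuHermitianTubeCocycle (mul_mem_UJ transl_mem_iff)
open Summit.HodgeConjecture.HodgeConjecture.Cruxes.HLiu418.K2LiuArchInducedTubeDefs
open Summit.HodgeConjecture.HodgeConjecture.Cruxes.HLiu418.K2LiuU22CompactPictureDefs
open Summit.HodgeConjecture.HodgeConjecture.Cruxes.HLiu418.K2LiuU22ShilovCoordinate (apply_eq_mul_apply_kU conjTranspose_shilov_mul)
open Summit.HodgeConjecture.HodgeConjecture.Cruxes.HLiu418.K2LiuKindWArchWhittakerLetter (exists_twistedWhittaker_continuation_of_posDef)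
open Summit.HodgeConjecture.HodgeConjecture.Cruxes.HLiu418.K2LiuKindWArchWhittakerLetterNegDef (exists_twistedWhittaker_continuation_of_negDef)
open Summit.HodgeConjecture.HodgeConjecture.Cruxes.HLiu418.K2LiuKindWArchWhittakerKPicture (kPicture_rightTranslate det_ne_zero_of_unitary)

/-! ## §1 The sign trichotomy of a non-degenerate `2 × 2` hermitian index -/

/-- `−hermTwo (a, z, b) = hermTwo (−a, −z, −b)`. [folklore] -/
theorem neg_hermTwo (c : ℝ × ℂ × ℝ) : -hermTwo c = hermTwo (-c.1, -c.2.1, -c.2.2) := by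
  ext i j
  fin_cases i <;> fin_cases j <;> simp [hermTwo]

/-- **SIGN TRICHOTOMY.**  A hermitian `2 × 2` matrix with non-zero determinant is POSITIVE DEFINITE, or NEGATIVE DEFINITE, or has NEGATIVE determinant (signature
`(1,1)`): `det = ab − |z|²` is real; if it is positive, `a ≠ 0` and Sylvester's criterion (★ `posDef_hermTwo_iff`) applies to `h` (`a > 0`) or to `−h` (`a < 0`).
[cite: Shimura1997, §16.4] -/
theorem sign_trichotomy {h : Matrix (Fin 2) (Fin 2) ℂ} (hh : h.IsHermitian) (hdet : h.det ≠ 0) :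
    h.PosDef ∨ (-h).PosDef ∨ h.det.re < 0 := by
  have hc := hermTwo_eq_of_isHermitian hh
  rw [← hc] at hdet ⊢
  rw [det_hermTwo] at hdet ⊢
  rw [Complex.ofReal_re]
  have hne : (h 0 0).re * (h 1 1).re - Complex.normSq (h 0 1) ≠ 0 := fun h0 => hdet (by rw [h0, Complex.ofReal_zero])
  rcases lt_or_gt_of_ne hne with hlt | hgt
  · exact Or.inr (Or.inr hlt)
  · have hz : 0 ≤ Complex.normSq (h 0 1) := Complex.normSq_nonneg _
    have hab : 0 < (h 0 0).re * (h 1 1).re := by linarith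
    have ha0 : (h 0 0).re ≠ 0 := fun h0 => by rw [h0, zero_mul] at hab; exact lt_irrefl _ hab
    rcases lt_or_gt_of_ne ha0 with ha | ha
    · refine Or.inr (Or.inl ?_)
      rw [neg_hermTwo, posDef_hermTwo_iff]
      refine ⟨by simpa using ha, ?_⟩
      simp only [Complex.normSq_neg, neg_mul_neg]
      linarith
    · exact Or.inl ((posDef_hermTwo_iff _).2 ⟨ha, by simpa using hgt⟩)

/-! ## §2 Canonicity of a section on `U(J)` and the identity-theorem upgrade of the abscissa -/

/-- **TWO SECTIONS WITH THE SAME PARAMETER AND THE SAME COMPACT PICTURE AGREE ON `U(J)`** (★ `apply_eq_mul_apply_kU`: a section is its compact picture `v ↦ F(k_v)` on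
the unitary Shilov coordinate times a multiplier depending only on `(χ, s)` and the point). [cite: Knapp1986, Ch. VII §1] [cite: Shimura1997, §16.4] -/
theorem apply_eq_of_picture_eq {l : Type*} [Fintype l] [DecidableEq l] {χ : ℂ → ℂ} {s : ℂ} {F F' : Matrix (l ⊕ l) (l ⊕ l) ℂ → ℂ}
    (hF : IsArchSiegelSection χ s F) (hF' : IsArchSiegelSection χ s F')
    (hpic : ∀ v : Matrix l l ℂ, vᴴ * v = 1 →
      F ((2 : ℂ)⁻¹ • fromBlocks (1 + v) (-(I • (1 - v))) (I • (1 - v)) (1 + v) : Matrix (l ⊕ l) (l ⊕ l) ℂ) =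
        F' ((2 : ℂ)⁻¹ • fromBlocks (1 + v) (-(I • (1 - v))) (I • (1 - v)) (1 + v) : Matrix (l ⊕ l) (l ⊕ l) ℂ))
    {y : Matrix (l ⊕ l) (l ⊕ l) ℂ} (hy : yᴴ * Matrix.J l ℂ * y = Matrix.J l ℂ) : F y = F' y := by
  rw [apply_eq_mul_apply_kU hF hy, apply_eq_mul_apply_kU hF' hy, hpic _ (conjTranspose_shilov_mul hy)]

/-- **HENCE THEIR TWISTED INTEGRALS OVER `x · N_Δ · g` AGREE** (`x, g ∈ U(J)`; `n(b) ∈ U(J)` for hermitian `b`, ★ `transl_mem_iff`): the left-hand side of the letter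
`hW` is ONE function of `s`, whichever section of picture `Q` is integrated. [cite: Shimura1997, §18.4] -/
theorem twistedIntegral_eq_of_picture_eq {χ : ℂ → ℂ} {s : ℂ} {F F' : Matrix (Fin 2 ⊕ Fin 2) (Fin 2 ⊕ Fin 2) ℂ → ℂ}
    (hF : IsArchSiegelSection χ s F) (hF' : IsArchSiegelSection χ s F')
    (hpic : ∀ v : Matrix (Fin 2) (Fin 2) ℂ, vᴴ * v = 1 →
      F ((2 : ℂ)⁻¹ • fromBlocks (1 + v) (-(I • (1 - v))) (I • (1 - v)) (1 + v) : Matrix (Fin 2 ⊕ Fin 2) (Fin 2 ⊕ Fin 2) ℂ) =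
        F' ((2 : ℂ)⁻¹ • fromBlocks (1 + v) (-(I • (1 - v))) (I • (1 - v)) (1 + v) : Matrix (Fin 2 ⊕ Fin 2) (Fin 2 ⊕ Fin 2) ℂ))
    {x g : Matrix (Fin 2 ⊕ Fin 2) (Fin 2 ⊕ Fin 2) ℂ} (hx : xᴴ * Matrix.J (Fin 2) ℂ * x = Matrix.J (Fin 2) ℂ) (hg : gᴴ * Matrix.J (Fin 2) ℂ * g = Matrix.J (Fin 2) ℂ)
    (e : Matrix (Fin 2) (Fin 2) ℂ → ℂ) :
    ∫ r : Fin 2 → Fin 2 → ℝ, F (x * fromBlocks 1 (hermOfReal r) 0 1 * g) * e (hermOfReal r) =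
      ∫ r : Fin 2 → Fin 2 → ℝ, F' (x * fromBlocks 1 (hermOfReal r) 0 1 * g) * e (hermOfReal r) := by
  refine congrArg (fun f : (Fin 2 → Fin 2 → ℝ) → ℂ => ∫ r, f r) (funext fun r => ?_)
  have hn : (fromBlocks 1 (hermOfReal r) 0 1 : Matrix (Fin 2 ⊕ Fin 2) (Fin 2 ⊕ Fin 2) ℂ)ᴴ * Matrix.J (Fin 2) ℂ * fromBlocks 1 (hermOfReal r) 0 1 =
      Matrix.J (Fin 2) ℂ := (transl_mem_iff _).2 (conjTranspose_hermOfReal r)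
  rw [apply_eq_of_picture_eq hF hF' hpic (mul_mem_UJ (mul_mem_UJ hx hn) hg)]

/-- **THE ABSCISSA UPGRADE `∃ s₀ ⇒ s₁` BY THE IDENTITY THEOREM.**  Fix a character `χ`, a picture `Q`, a frame `(x, g)` in `U(J)`, a twist `e`, and `0 ≤ s₁`.  Suppose (`hhol`) that,
given any section of picture `Q` at a parameter in `{s₁ < re}`, a family of sections `G s ∈ I_w(s, χ)` of compact picture `Q` exists whose twisted integral
`W(s) = ∫ G s (x·n(b)·g) e(b) db` is holomorphic on `{s₁ < re}` (payer: the flat twist of the given section), and (`hW₀`) the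
letter holds on `{s₀ < re}` for SOME `s₀` with a continuation `Ew` holomorphic on `{0 < re}`.  Then the letter holds on `{s₁ < re}` with the same `Ew`: every section of
picture `Q` has twisted integral `W(s)` (§2 canonicity), and `Ew = W` on the connected `{s₁ < re}` because they agree on `{max s₀ s₁ < re}`
(`AnalyticOnNhd.eqOn_of_preconnected_of_eventuallyEq`). [cite: MoeglinWaldspurger1995, IV.1.9] [cite: Shimura1997, §18.4] -/
theorem hW_of_abscissa_of_hol {χ : ℂ → ℂ} {Q : Carrier} {x g : Matrix (Fin 2 ⊕ Fin 2) (Fin 2 ⊕ Fin 2) ℂ}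
    (hx : xᴴ * Matrix.J (Fin 2) ℂ * x = Matrix.J (Fin 2) ℂ) (hg : gᴴ * Matrix.J (Fin 2) ℂ * g = Matrix.J (Fin 2) ℂ)
    {e : Matrix (Fin 2) (Fin 2) ℂ → ℂ} {s₁ : ℝ} (hs₁ : 0 ≤ s₁)
    (hhol : ∀ s' : ℂ, s₁ < s'.re → ∀ F₀ : Matrix (Fin 2 ⊕ Fin 2) (Fin 2 ⊕ Fin 2) ℂ → ℂ, IsArchSiegelSection χ s' F₀ →
      (∀ (v : Matrix (Fin 2) (Fin 2) ℂ), vᴴ * v = 1 → ∀ hv : v.det ≠ 0,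
        F₀ ((2 : ℂ)⁻¹ • fromBlocks (1 + v) (-(I • (1 - v))) (I • (1 - v)) (1 + v) : Matrix (Fin 2 ⊕ Fin 2) (Fin 2 ⊕ Fin 2) ℂ) = evalAt v hv Q) →
      ∃ G : ℂ → Matrix (Fin 2 ⊕ Fin 2) (Fin 2 ⊕ Fin 2) ℂ → ℂ, (∀ s : ℂ, s₁ < s.re → IsArchSiegelSection χ s (G s)) ∧
      (∀ s : ℂ, s₁ < s.re → ∀ (v : Matrix (Fin 2) (Fin 2) ℂ), vᴴ * v = 1 → ∀ hv : v.det ≠ 0,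
        G s ((2 : ℂ)⁻¹ • fromBlocks (1 + v) (-(I • (1 - v))) (I • (1 - v)) (1 + v) : Matrix (Fin 2 ⊕ Fin 2) (Fin 2 ⊕ Fin 2) ℂ) = evalAt v hv Q) ∧
      DifferentiableOn ℂ (fun s : ℂ => ∫ r : Fin 2 → Fin 2 → ℝ, G s (x * fromBlocks 1 (hermOfReal r) 0 1 * g) * e (hermOfReal r)) {s : ℂ | s₁ < s.re})
    (hW₀ : ∃ (Ew : ℂ → ℂ) (s₀ : ℝ), DifferentiableOn ℂ Ew {s : ℂ | 0 < s.re} ∧ ∀ s : ℂ, s₀ < s.re →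
      ∀ F : Matrix (Fin 2 ⊕ Fin 2) (Fin 2 ⊕ Fin 2) ℂ → ℂ, IsArchSiegelSection χ s F →
        (∀ (v : Matrix (Fin 2) (Fin 2) ℂ), vᴴ * v = 1 → ∀ hv : v.det ≠ 0,
          F ((2 : ℂ)⁻¹ • fromBlocks (1 + v) (-(I • (1 - v))) (I • (1 - v)) (1 + v) : Matrix (Fin 2 ⊕ Fin 2) (Fin 2 ⊕ Fin 2) ℂ) = evalAt v hv Q) →
        ∫ r : Fin 2 → Fin 2 → ℝ, F (x * fromBlocks 1 (hermOfReal r) 0 1 * g) * e (hermOfReal r) = Ew s) :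
    ∃ Ew : ℂ → ℂ, DifferentiableOn ℂ Ew {s : ℂ | 0 < s.re} ∧ ∀ s : ℂ, s₁ < s.re →
      ∀ F : Matrix (Fin 2 ⊕ Fin 2) (Fin 2 ⊕ Fin 2) ℂ → ℂ, IsArchSiegelSection χ s F →
        (∀ (v : Matrix (Fin 2) (Fin 2) ℂ), vᴴ * v = 1 → ∀ hv : v.det ≠ 0,
          F ((2 : ℂ)⁻¹ • fromBlocks (1 + v) (-(I • (1 - v))) (I • (1 - v)) (1 + v) : Matrix (Fin 2 ⊕ Fin 2) (Fin 2 ⊕ Fin 2) ℂ) = evalAt v hv Q) →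
        ∫ r : Fin 2 → Fin 2 → ℝ, F (x * fromBlocks 1 (hermOfReal r) 0 1 * g) * e (hermOfReal r) = Ew s := by
  obtain ⟨Ew, s₀, hEw, hform⟩ := hW₀
  refine ⟨Ew, hEw, fun s hs F hF hFQ => ?_⟩
  -- a holomorphic family of sections of picture `Q` (the by-value letter, fed the section at hand)
  obtain ⟨G, hG, hGQ, hGhol⟩ := hhol s hs F hF hFQ
  -- the open connected window `U = {s₁ < re}` and the far window `V = {max s₀ s₁ < re}`
  have hU : IsOpen {s : ℂ | s₁ < s.re} := isOpen_lt continuous_const Complex.continuous_re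
  have hUc : IsPreconnected {s : ℂ | s₁ < s.re} := (convex_halfSpace_re_gt s₁).isPreconnected
  have hV : IsOpen {s : ℂ | max s₀ s₁ < s.re} := isOpen_lt continuous_const Complex.continuous_re
  set z₀ : ℂ := ((max s₀ s₁ + 1 : ℝ) : ℂ) with hz₀
  have hre : z₀.re = max s₀ s₁ + 1 := by rw [hz₀, Complex.ofReal_re]
  have hz₀U : z₀ ∈ {s : ℂ | s₁ < s.re} := by
    show s₁ < z₀.re
    rw [hre]
    exact lt_of_le_of_lt (le_max_right s₀ s₁) (lt_add_one _)
  have hz₀V : z₀ ∈ {s : ℂ | max s₀ s₁ < s.re} := by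
    show max s₀ s₁ < z₀.re
    rw [hre]
    exact lt_add_one _
  -- `Ew = W` near `z₀` (the letter on the far window, applied to the section `G s`)
  have hev : Ew =ᶠ[𝓝 z₀] fun s : ℂ => ∫ r : Fin 2 → Fin 2 → ℝ, G s (x * fromBlocks 1 (hermOfReal r) 0 1 * g) * e (hermOfReal r) := by
    filter_upwards [hV.mem_nhds hz₀V] with s' hs'
    have h₀ : s₀ < s'.re := lt_of_le_of_lt (le_max_left s₀ s₁) hs'
    have h₁ : s₁ < s'.re := lt_of_le_of_lt (le_max_right s₀ s₁) hs'
    exact (hform s' h₀ (G s') (hG s' h₁) (hGQ s' h₁)).symm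
  -- identity theorem on `U`
  have hEwU : AnalyticOnNhd ℂ Ew {s : ℂ | s₁ < s.re} :=
    (hEw.mono fun s (hs : s₁ < s.re) => lt_of_le_of_lt hs₁ hs).analyticOnNhd hU
  have hEqOn := hEwU.eqOn_of_preconnected_of_eventuallyEq (hGhol.analyticOnNhd hU) hUc hz₀U hev
  -- canonicity: the section `F` and the section `G s` have the same twisted integral
  have hpic : ∀ v : Matrix (Fin 2) (Fin 2) ℂ, vᴴ * v = 1 →
      F ((2 : ℂ)⁻¹ • fromBlocks (1 + v) (-(I • (1 - v))) (I • (1 - v)) (1 + v) : Matrix (Fin 2 ⊕ Fin 2) (Fin 2 ⊕ Fin 2) ℂ) =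
        G s ((2 : ℂ)⁻¹ • fromBlocks (1 + v) (-(I • (1 - v))) (I • (1 - v)) (1 + v) : Matrix (Fin 2 ⊕ Fin 2) (Fin 2 ⊕ Fin 2) ℂ) := fun v hv => by
    rw [hFQ v hv (det_ne_zero_of_unitary hv), hGQ s hs v hv (det_ne_zero_of_unitary hv)]
  rw [twistedIntegral_eq_of_picture_eq hF (hG s hs) hpic hx hg e]
  exact (hEqOn hs).symm

/-! ## §3 HEAD — the letter `hW`, dispatched on the sign type of the framed index -/

/-- **THE PER-PLACE ARCHIMEDEAN WHITTAKER LETTER `hW`, BY SIGN CASES** (payer by name of the by-value letter (β) of `K2LiuKindWArchContinuationOfRecord :: hex_of_std`;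
GUARDED by `good S` — the consumer instantiates `good S := det ↑S ≠ 0` (KW desk byte repair 00:42:11Z: `hW'`), `k w := -(t w.1)`, `Pt S h w := Fr (h_∞·g) w`, `s₁ := 2∕2`).
BY-VALUE LETTERS: the weight window `hk` (★ JUNCTION, load-bearing), the frame letters
`hx`, `hPt`, the per-place index reading `(hidx, hherm, hdet, hebr)` of the twist, the holomorphy letter `hWhol` (through any section of picture `Q` on `{s₁ < re}`, one family of sections of picture `Q` with holomorphic twisted
integral), and the INDEFINITE head `hInd` («Φ6b-ind», the definite heads' telescope ∀-closed at `hidx'ᴴ = hidx'`, `hidx'.det.re < 0`).  PROOF: §1 trichotomy of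
`hidx S h w`; the definite cases are ★ `exists_twistedWhittaker_continuation_of_posDef` ∕ ★ `…_of_negDef` BY NAME with their `hKpic` PAID by ★ W1
`kPicture_rightTranslate (k w) Q`; the indefinite case is `hInd` fed the same bridge; each gives the letter on `{s₀ < re}`, and §2 `hW_of_abscissa_of_hol` moves it to
`{s₁ < re}`. [cite: Shimura1997, §16.4, §18.4] [cite: KudlaRallis1994, §1] [cite: MoeglinWaldspurger1995, IV.1.9] -/
theorem hW_of_signCases {ιS ιh W : Type*} (good : ιS → Prop) (k : W → ℤ) (hk : ∀ w, -2 ≤ k w)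
    (B C : W → Matrix (Fin 2) (Fin 2) ℂ)
    (hx : ∀ w, (fromBlocks 0 (B w) (C w) 0 : Matrix (Fin 2 ⊕ Fin 2) (Fin 2 ⊕ Fin 2) ℂ)ᴴ * Matrix.J (Fin 2) ℂ *
      (fromBlocks 0 (B w) (C w) 0 : Matrix (Fin 2 ⊕ Fin 2) (Fin 2 ⊕ Fin 2) ℂ) = Matrix.J (Fin 2) ℂ)
    (Pt : ιS → ιh → W → Matrix (Fin 2 ⊕ Fin 2) (Fin 2 ⊕ Fin 2) ℂ) (hPt : ∀ S h w, (Pt S h w)ᴴ * Matrix.J (Fin 2) ℂ * Pt S h w = Matrix.J (Fin 2) ℂ)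
    (eb : ιS → ιh → W → Matrix (Fin 2) (Fin 2) ℂ → ℂ) (hidx : ιS → ιh → W → Matrix (Fin 2) (Fin 2) ℂ)
    (hherm : ∀ S h w, (hidx S h w)ᴴ = hidx S h w) (hdet : ∀ S, good S → ∀ h w, (hidx S h w).det ≠ 0)
    (hebr : ∀ S h w (b : Matrix (Fin 2) (Fin 2) ℂ), eb S h w b = cexp (-(2 * Real.pi * I) * (hidx S h w * b).trace))
    (s₁ : ℝ) (hs₁ : 0 ≤ s₁)
    (hWhol : ∀ (S : ιS), good S → ∀ (h : ιh) (w : W) (Q : Carrier), ∀ s' : ℂ, s₁ < s'.re → ∀ F₀ : Matrix (Fin 2 ⊕ Fin 2) (Fin 2 ⊕ Fin 2) ℂ → ℂ,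
      IsArchSiegelSection (fun z : ℂ => (conj z / ((‖z‖ : ℝ) : ℂ)) ^ (k w)) s' F₀ →
      (∀ (v : Matrix (Fin 2) (Fin 2) ℂ), vᴴ * v = 1 → ∀ hv : v.det ≠ 0,
        F₀ ((2 : ℂ)⁻¹ • fromBlocks (1 + v) (-(I • (1 - v))) (I • (1 - v)) (1 + v) : Matrix (Fin 2 ⊕ Fin 2) (Fin 2 ⊕ Fin 2) ℂ) = evalAt v hv Q) →
      ∃ G : ℂ → Matrix (Fin 2 ⊕ Fin 2) (Fin 2 ⊕ Fin 2) ℂ → ℂ,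
      (∀ s : ℂ, s₁ < s.re → IsArchSiegelSection (fun z : ℂ => (conj z / ((‖z‖ : ℝ) : ℂ)) ^ (k w)) s (G s)) ∧
      (∀ s : ℂ, s₁ < s.re → ∀ (v : Matrix (Fin 2) (Fin 2) ℂ), vᴴ * v = 1 → ∀ hv : v.det ≠ 0,
        G s ((2 : ℂ)⁻¹ • fromBlocks (1 + v) (-(I • (1 - v))) (I • (1 - v)) (1 + v) : Matrix (Fin 2 ⊕ Fin 2) (Fin 2 ⊕ Fin 2) ℂ) = evalAt v hv Q) ∧
      DifferentiableOn ℂ (fun s : ℂ => ∫ r : Fin 2 → Fin 2 → ℝ,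
        G s ((fromBlocks 0 (B w) (C w) 0 : Matrix (Fin 2 ⊕ Fin 2) (Fin 2 ⊕ Fin 2) ℂ) * fromBlocks 1 (hermOfReal r) 0 1 * Pt S h w) * eb S h w (hermOfReal r))
        {s : ℂ | s₁ < s.re})
    (hInd : ∀ (k' : ℤ), -2 ≤ k' → ∀ (Q : Carrier) (B' C' : Matrix (Fin 2) (Fin 2) ℂ),
      (fromBlocks 0 B' C' 0 : Matrix (Fin 2 ⊕ Fin 2) (Fin 2 ⊕ Fin 2) ℂ)ᴴ * Matrix.J (Fin 2) ℂ * (fromBlocks 0 B' C' 0 : Matrix (Fin 2 ⊕ Fin 2) (Fin 2 ⊕ Fin 2) ℂ) =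
        Matrix.J (Fin 2) ℂ →
      ∀ (g' : Matrix (Fin 2 ⊕ Fin 2) (Fin 2 ⊕ Fin 2) ℂ), g'ᴴ * Matrix.J (Fin 2) ℂ * g' = Matrix.J (Fin 2) ℂ →
      ∀ (hidx' : Matrix (Fin 2) (Fin 2) ℂ), hidx'ᴴ = hidx' → hidx'.det.re < 0 →
      ∀ (eb' : Matrix (Fin 2) (Fin 2) ℂ → ℂ), (∀ b, eb' b = cexp (-(2 * Real.pi * I) * (hidx' * b).trace)) →
      (∀ k₀ : Matrix (Fin 2 ⊕ Fin 2) (Fin 2 ⊕ Fin 2) ℂ, k₀ᴴ * Matrix.J (Fin 2) ℂ * k₀ = Matrix.J (Fin 2) ℂ →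
        moeb k₀ (I • (1 : Matrix (Fin 2) (Fin 2) ℂ)) = I • 1 →
        ∃ P : MvPolynomial (((Fin 2 ⊕ Fin 2) × (Fin 2 ⊕ Fin 2)) ⊕ ((Fin 2 ⊕ Fin 2) × (Fin 2 ⊕ Fin 2))) ℂ,
          ∀ (s : ℂ) (F : Matrix (Fin 2 ⊕ Fin 2) (Fin 2 ⊕ Fin 2) ℂ → ℂ), IsArchSiegelSection (fun z : ℂ => (conj z / ((‖z‖ : ℝ) : ℂ)) ^ k') s F →
            (∀ (v : Matrix (Fin 2) (Fin 2) ℂ), vᴴ * v = 1 → ∀ hv : v.det ≠ 0,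
              F ((2 : ℂ)⁻¹ • fromBlocks (1 + v) (-(I • (1 - v))) (I • (1 - v)) (1 + v) : Matrix (Fin 2 ⊕ Fin 2) (Fin 2 ⊕ Fin 2) ℂ) = evalAt v hv Q) →
            ∀ u : Matrix (Fin 2 ⊕ Fin 2) (Fin 2 ⊕ Fin 2) ℂ, uᴴ * Matrix.J (Fin 2) ℂ * u = Matrix.J (Fin 2) ℂ → moeb u (I • (1 : Matrix (Fin 2) (Fin 2) ℂ)) = I • 1 →
              F (u * k₀) = MvPolynomial.eval (Sum.elim (fun pq => u pq.1 pq.2) (fun pq => conj (u pq.1 pq.2))) P) →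
      ∃ (Ew : ℂ → ℂ) (s₀ : ℝ), DifferentiableOn ℂ Ew {s : ℂ | 0 < s.re} ∧ ∀ s : ℂ, s₀ < s.re →
        ∀ F : Matrix (Fin 2 ⊕ Fin 2) (Fin 2 ⊕ Fin 2) ℂ → ℂ, IsArchSiegelSection (fun z : ℂ => (conj z / ((‖z‖ : ℝ) : ℂ)) ^ k') s F →
          (∀ (v : Matrix (Fin 2) (Fin 2) ℂ), vᴴ * v = 1 → ∀ hv : v.det ≠ 0,
            F ((2 : ℂ)⁻¹ • fromBlocks (1 + v) (-(I • (1 - v))) (I • (1 - v)) (1 + v) : Matrix (Fin 2 ⊕ Fin 2) (Fin 2 ⊕ Fin 2) ℂ) = evalAt v hv Q) →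
          ∫ r : Fin 2 → Fin 2 → ℝ, F ((fromBlocks 0 B' C' 0 : Matrix (Fin 2 ⊕ Fin 2) (Fin 2 ⊕ Fin 2) ℂ) * fromBlocks 1 (hermOfReal r) 0 1 * g') * eb' (hermOfReal r) =
            Ew s) :
    ∀ (S : ιS), good S → ∀ (h : ιh) (w : W) (Q : Carrier), ∃ Ew : ℂ → ℂ, DifferentiableOn ℂ Ew {s : ℂ | 0 < s.re} ∧ ∀ s : ℂ, s₁ < s.re →
      ∀ F : Matrix (Fin 2 ⊕ Fin 2) (Fin 2 ⊕ Fin 2) ℂ → ℂ, IsArchSiegelSection (fun z : ℂ => (conj z / ((‖z‖ : ℝ) : ℂ)) ^ (k w)) s F →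
        (∀ (v : Matrix (Fin 2) (Fin 2) ℂ), vᴴ * v = 1 → ∀ hv : v.det ≠ 0,
          F ((2 : ℂ)⁻¹ • fromBlocks (1 + v) (-(I • (1 - v))) (I • (1 - v)) (1 + v) : Matrix (Fin 2 ⊕ Fin 2) (Fin 2 ⊕ Fin 2) ℂ) = evalAt v hv Q) →
        ∫ x : Fin 2 → Fin 2 → ℝ, F ((fromBlocks 0 (B w) (C w) 0 : Matrix (Fin 2 ⊕ Fin 2) (Fin 2 ⊕ Fin 2) ℂ) * fromBlocks 1 (hermOfReal x) 0 1 * Pt S h w) *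
          eb S h w (hermOfReal x) = Ew s := by
  intro S hS h w Q
  refine hW_of_abscissa_of_hol (hx w) (hPt S h w) hs₁ (hWhol S hS h w Q) ?_
  rcases sign_trichotomy (hherm S h w) (hdet S hS h w) with hpos | hneg | hind
  · exact exists_twistedWhittaker_continuation_of_posDef (hk w) Q (hx w) (hPt S h w) hpos (hebr S h w) (kPicture_rightTranslate (k w) Q)
  · exact exists_twistedWhittaker_continuation_of_negDef (hk w) Q (hx w) (hPt S h w) hneg (hebr S h w) (kPicture_rightTranslate (k w) Q)
  · exact hInd (k w) (hk w) Q (B w) (C w) (hx w) (Pt S h w) (hPt S h w) (hidx S h w) (hherm S h w) hind (eb S h w) (hebr S h w)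
      (kPicture_rightTranslate (k w) Q)

end Summit.HodgeConjecture.HodgeConjecture.Cruxes.HLiu418.K2LiuKindWArchWhittakerLetterDispatch

end
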